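import Literature.Computability.QuantumComplexity.CWrapKernel
import Literature.Computability.QuantumComplexity.CWrapUniform
import Literature.Computability.Cryptography.QuantumCircuitProofs
import Literature.Computability.Cryptography.ShorProofs
import HarnessLib

/-!
# Classical wrapping inside quantum search, VII: the assembly (`isQSolvable_classicalWrap` discharged)

Trunk `CryptoQuantFine`; closes the construction of `CWrapLayout.lean` … `CWrapUniform.lean`
(files I–VI) by discharging the named fact
`Literature.Computability.Cryptography.isQSolvable_classicalWrap` (`Cryptography/ShorProofs.lean`):
bounded-error quantum search solvability is closed under deterministic polynomial-time classical
pre- and post-processing `h, g ∈ FP` — "`P`-computations are free inside `BQP`"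
(Bernstein–Vazirani 1997, §8; Nielsen–Chuang 2010, §3.2.5, §4.5.5). Given `h, g ∈ FP` and a
poly-time uniform oracle-free family `F` solving `R` with probability `≥ 2/3`, the parameters of
the wrapped family are: a machine of `h` with a time bound `(n+2)^e`
(`RevClean.exists_outputsWithin_pow_of_mem_FP`), a polynomial bounding the ancilla count of `F`
(`QCircuitFamily.IsUniform.isPolySize_holds`, `QuantumCircuitProofs.lean`), and a machine of the
wrapped post-processor `gWrap g ∈ FP` (`CWrap.gWrap_mem_FP`, file III); then `CWrap.family` is
oracle-free (`family_isOracleFree`, IV), uniform (`family_isUniform`, VI) and succeeds with at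
least the probability of `F` on `h x` (`kernelProb_family_ge`, V).

## References

* E. Bernstein, U. Vazirani, *Quantum complexity theory*, SIAM J. Comput. 26 (1997), §8
  (`BQP^BQP = BQP`; classical computation inside quantum machines).
* M. A. Nielsen, I. L. Chuang, *Quantum Computation and Quantum Information*, CUP 2010, §3.2.5,
  §4.5.5.
-/

noncomputable section

namespace Literature.Computability.QuantumComplexity

namespace CWrap

open _root_.Computability Complexity Cryptography RevClean

/-- **The parameters of the wrapped family** from the data of `isQSolvable_classicalWrap`:
machines of `h` and of `gWrap g` with `(n+2)^e` time bounds, and a polynomial ancilla bound of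
the given uniform family. [cite: BernsteinVazirani1997, §8 (classical computation inside quantum machines)] -/
theorem exists_params {h g : List Bool → List Bool} (hh : h ∈ FP) (hg : g ∈ FP)
    {F : QCircuitFamily cliffordT} (hU : F.IsUniform) :
    ∃ P : Params, P.h = h ∧ P.g = g ∧ P.F = F := by
  obtain ⟨eh, Mh, hMh⟩ := exists_outputsWithin_pow_of_mem_FP hh
  obtain ⟨pF, hpF⟩ := QCircuitFamily.IsUniform.isPolySize_holds hU
  let Q : Layout := ⟨h, eh, Mh, hMh, F, pF, fun m => (hpF m).2⟩
  obtain ⟨eg, Mg, hMg⟩ := exists_outputsWithin_pow_of_mem_FP (gWrap_mem_FP (Q := Q) hg hU)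
  exact ⟨⟨Q, g, eg, Mg, hMg⟩, rfl, rfl, rfl⟩

end CWrap

end Literature.Computability.QuantumComplexity

namespace Literature.Computability.Cryptography

open _root_.Computability Complexity QuantumComplexity

/-- **Discharge of `isQSolvable_classicalWrap`** (`ShorProofs.lean`): if `h, g ∈ FP` and the
search problem `R` is solvable in bounded-error quantum polynomial time by the oracle-free uniform
family `F`, then the wrapped family `CWrap.family P` (compute `h x` cleanly, route it by its
length into the block of the matching copy of `F`, run every copy, compute `gWrap g` cleanly on
everything and swap its output to the front) is oracle-free, uniform, and outputs a string with
prefix `g ⟨x, y⟩`, `y ∈ R (h x)`, with probability `≥ F.kernelProb (h x) (R (h x)) ≥ 2/3`.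
[cite: BernsteinVazirani1997, §8 (BQP^BQP = BQP; classical computation inside quantum machines)] -/
theorem isQSolvable_classicalWrap_holds : isQSolvable_classicalWrap := by
  intro h g R hh hg hR
  obtain ⟨F, hFfree, hU, hF⟩ := hR
  obtain ⟨P, rfl, rfl, rfl⟩ := CWrap.exists_params hh hg hU
  exact ⟨CWrap.family P, CWrap.family_isOracleFree P hFfree, CWrap.family_isUniform P hU,
    fun x => (hF (P.h x)).trans (CWrap.kernelProb_family_ge P x R)⟩

end Literature.Computability.Cryptography

end
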